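import Summits.PneNP.PneNP.Theorems.PositionalGamesParityMonotoneQuasipolyUpperDefs

/-!
# Progress-measure lifting: the order core and the iteration
(route PneNP/PositionalGames, support item stmt-PneNP-1298 `ParityMonotoneQuasipolyUpper`)

* `List.take` is monotone for the lexicographic order on `List ℕ`; truncations `trunc i` are
  monotone and compatible across levels (`trunc_le_trunc_of_le`);
* the progress condition `Prog` is upward closed in the source and downward closed in the target;
* `lift i s m` is the least progressive source value, it is monotone, `lift ⊤ = ⊤`;
* the threshold transform: `m < theta i s t ↔ lift i s m < t` (`lt_theta_iff`) — this is what
  makes one round of lifting an `∧/∨`-combination of edge bits and previous threshold bits;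
* the iteration `iter` increases, stays below every prefixpoint, and is stable after
  `|V| · |Val U|` rounds (`iter_stable`, rank-sum potential).
-/

namespace Summit.PneNP.PneNP.Theorems.ParityLifting

set_option linter.dupNamespace false -- `Summit.PneNP.PneNP.…`: summit = sub-problem (D-0017)

open Literature.Combinatorics.Games

variable {U : Finset (List ℕ)} {V : Type*} [Fintype V]

/-! ## Order lemmas -/

section Order
/-- `List.take` is strictly-then-weakly monotone for the lexicographic order: `a < b` gives
`a.take i ≤ b.take i`. -/
theorem take_le_take_of_lt : ∀ (i : ℕ) {a b : List ℕ}, a < b → a.take i ≤ b.take i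
  | 0, a, b, _ => by simp
  | i + 1, a, b, h => by
    have h' : List.Lex (· < ·) a b := h
    cases h' with
    | nil =>
      simp only [List.take_succ_cons, List.take_nil]
      exact le_of_lt List.Lex.nil
    | rel hxy =>
      simp only [List.take_succ_cons]
      exact le_of_lt (List.Lex.rel hxy)
    | cons htl =>
      simp only [List.take_succ_cons]
      rcases (take_le_take_of_lt i htl).lt_or_eq with hlt | heq
      · exact le_of_lt (List.Lex.cons hlt)
      · rw [heq]

/-- `List.take` is monotone for the lexicographic order on `List ℕ`. -/
theorem take_mono_lex {a b : List ℕ} (h : a ≤ b) (i : ℕ) : a.take i ≤ b.take i := by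
  rcases h.lt_or_eq with hlt | rfl
  · exact take_le_take_of_lt i hlt
  · exact le_rfl

/-- `trunc i` is monotone. -/
theorem trunc_mono (i : ℕ) : Monotone (trunc (U := U) i) :=
  WithTop.monotone_map_iff.2 (WithBot.monotone_map_iff.2 fun _ _ h => take_mono_lex h i)

/-- `trunc i ⊤ = ⊤`. -/
@[simp] theorem trunc_top (i : ℕ) : trunc (U := U) i ⊤ = ⊤ := rfl

/-- `trunc` of a label. -/
@[simp] theorem trunc_coe (i : ℕ) (l : {l : List ℕ // l ∈ U}) :
    trunc i ((l : WithBot {l : List ℕ // l ∈ U}) : Val U) = ((l.1.take i : List ℕ) : WithBot (List ℕ)) :=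
  rfl

/-- Only `⊤` truncates to `⊤`. -/
theorem trunc_eq_top_iff {i : ℕ} {m : Val U} : trunc i m = ⊤ ↔ m = ⊤ := by
  induction m using WithTop.recTopCoe with
  | top => simp
  | coe m => simp [trunc]

/-- Truncating to `j ≤ i` components factors through truncating to `i` components. -/
theorem trunc_eq_map_trunc {i j : ℕ} (hji : j ≤ i) (m : Val U) :
    trunc j m = WithTop.map (WithBot.map (List.take j)) (trunc i m) := by
  induction m using WithTop.recTopCoe with
  | top => rfl
  | coe m =>
    induction m using WithBot.recBotCoe with
    | bot => rfl
    | coe l =>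
      simp only [trunc, WithTop.map_coe, WithBot.map_coe, List.take_take, min_eq_left hji]

/-- Truncations are compatible: `≤` at level `i` gives `≤` at every level `j ≤ i`. -/
theorem trunc_le_trunc_of_le {i j : ℕ} (hji : j ≤ i) {m m' : Val U} (h : trunc i m ≤ trunc i m') :
    trunc j m ≤ trunc j m' := by
  rw [trunc_eq_map_trunc hji m, trunc_eq_map_trunc hji m']
  exact (WithTop.monotone_map_iff.2 (WithBot.monotone_map_iff.2 fun _ _ h => take_mono_lex h j)) h

/-! ### The progress condition -/

/-- Unfolding `Prog` for a strict (odd) source. -/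
theorem prog_true {i : ℕ} {m' m : Val U} : Prog i true m' m ↔ trunc i m < trunc i m' := by
  simp [Prog]

/-- Unfolding `Prog` for a non-strict (even) source. -/
theorem prog_false {i : ℕ} {m' m : Val U} : Prog i false m' m ↔ trunc i m ≤ trunc i m' := by
  simp [Prog]

/-- In either case the progress condition gives `≤` of truncations. -/
theorem Prog.le {i : ℕ} {s : Bool} {m' m : Val U} (h : Prog i s m' m) : trunc i m ≤ trunc i m' := by
  cases s
  · exact prog_false.1 h
  · exact (prog_true.1 h).le

/-- The progress condition is upward closed in the source value. -/
theorem Prog.mono_left {i : ℕ} {s : Bool} {m' m'' m : Val U} (h : Prog i s m' m) (hle : m' ≤ m'') :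
    Prog i s m'' m := by
  cases s
  · exact prog_false.2 ((prog_false.1 h).trans (trunc_mono i hle))
  · exact prog_true.2 ((prog_true.1 h).trans_le (trunc_mono i hle))

/-- The progress condition is downward closed in the target value. -/
theorem Prog.anti_right {i : ℕ} {s : Bool} {m' m m₀ : Val U} (h : Prog i s m' m) (hle : m₀ ≤ m) :
    Prog i s m' m₀ := by
  cases s
  · exact prog_false.2 ((trunc_mono i hle).trans (prog_false.1 h))
  · exact prog_true.2 ((trunc_mono i hle).trans_lt (prog_true.1 h))

/-- A progressive edge from a non-`⊤` source has a non-`⊤` target. -/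
theorem Prog.lt_top {i : ℕ} {s : Bool} {m' m : Val U} (h : Prog i s m' m) (hm' : m' < ⊤) :
    m < ⊤ := by
  rw [lt_top_iff_ne_top] at hm' ⊢
  intro hm
  subst hm
  have h1 := Prog.le h
  rw [trunc_top, top_le_iff, trunc_eq_top_iff] at h1
  exact hm' h1

/-! ### `lift` -/

/-- `lift i s m` is below every value progressive against `m`. -/
theorem lift_le_of_prog {i : ℕ} {s : Bool} {m' m : Val U} (h : Prog i s m' m) : lift i s m ≤ m' := by
  classical
  unfold lift
  exact Finset.inf_le (f := id) (Finset.mem_filter.2 ⟨Finset.mem_univ _, h⟩)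

/-- If some value is progressive against `m`, so is `lift i s m` (the infimum is attained). -/
theorem prog_lift_of_exists {i : ℕ} {s : Bool} {m : Val U} (h : ∃ m', Prog i s m' m) :
    Prog i s (lift i s m) m := by
  classical
  obtain ⟨m', hm'⟩ := h
  have hne : (Finset.univ.filter fun m'' : Val U => Prog i s m'' m).Nonempty :=
    ⟨m', Finset.mem_filter.2 ⟨Finset.mem_univ _, hm'⟩⟩
  obtain ⟨m₀, hm₀, heq⟩ := Finset.exists_mem_eq_inf _ hne id
  unfold lift
  rw [heq]
  exact (Finset.mem_filter.1 hm₀).2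

/-- `lift i s ⊤ = ⊤`. -/
theorem lift_top (i : ℕ) (s : Bool) : lift (U := U) i s ⊤ = ⊤ := by
  classical
  unfold lift
  apply le_antisymm le_top
  apply Finset.le_inf
  intro m' hm'
  have h := Prog.le (Finset.mem_filter.1 hm').2
  rw [trunc_top, top_le_iff, trunc_eq_top_iff] at h
  exact le_of_eq h.symm

/-- If `lift i s m ≠ ⊤` then it is progressive against `m`. -/
theorem prog_lift_of_ne_top {i : ℕ} {s : Bool} {m : Val U} (h : lift i s m ≠ ⊤) :
    Prog i s (lift i s m) m := by
  classical
  apply prog_lift_of_exists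
  by_contra hno
  push Not at hno
  apply h
  unfold lift
  rw [Finset.filter_eq_empty_iff.2 fun m' _ => hno m', Finset.inf_empty]

/-- `lift i s` is monotone. -/
theorem lift_mono (i : ℕ) (s : Bool) : Monotone (lift (U := U) i s) := by
  classical
  intro m₁ m₂ h
  unfold lift
  apply Finset.inf_mono
  intro m' hm'
  rw [Finset.mem_filter] at hm' ⊢
  exact ⟨hm'.1, Prog.anti_right hm'.2 h⟩

/-! ### `theta` -/

/-- **The threshold transform**: `m < theta i s t ↔ lift i s m < t`. -/
theorem lt_theta_iff {i : ℕ} {s : Bool} {t m : Val U} : m < theta i s t ↔ lift i s m < t := by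
  classical
  constructor
  · intro hm
    by_contra hge
    rw [not_lt] at hge
    have : theta i s t ≤ m := by
      unfold theta
      exact Finset.inf_le (f := id) (Finset.mem_filter.2 ⟨Finset.mem_univ _, hge⟩)
    exact absurd hm (not_lt.2 this)
  · intro hlt
    by_contra hge
    rw [not_lt] at hge
    have hne : (Finset.univ.filter fun m : Val U => t ≤ lift i s m).Nonempty :=
      ⟨⊤, Finset.mem_filter.2 ⟨Finset.mem_univ _, by rw [lift_top]; exact le_top⟩⟩
    obtain ⟨m₀, hm₀, heq⟩ := Finset.exists_mem_eq_inf _ hne id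
    have hθ : t ≤ lift i s (theta i s t) := by
      unfold theta
      rw [heq]
      exact (Finset.mem_filter.1 hm₀).2
    exact absurd ((hθ.trans (lift_mono i s hge)).trans_lt hlt) (lt_irrefl _)

end Order

/-! ## The lifting iteration: monotonicity, stabilisation, least prefixpoint -/

section Dynamics

variable (o : V → Bool) (p : V → ℕ) (H : ℕ) (x : V × V → Bool)

/-- One round of lifting is monotone in the measure. -/
theorem step_mono : Monotone (step (U := U) o p H x) := by
  classical
  intro μ ν h u
  unfold step
  split_ifs with hu
  · exact Finset.inf_mono_fun fun w _ => lift_mono _ _ (h w)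
  · exact Finset.sup_mono_fun fun w _ => lift_mono _ _ (h w)

/-- `iter (k+1) = step (iter k)`. -/
theorem iter_succ (k : ℕ) : iter (U := U) o p H x (k + 1) = step o p H x (iter o p H x k) :=
  Function.iterate_succ_apply' _ _ _

/-- The iterates increase. -/
theorem iter_le_iter_succ (k : ℕ) : iter (U := U) o p H x k ≤ iter o p H x (k + 1) := by
  induction k with
  | zero => exact bot_le
  | succ k ih =>
    rw [iter_succ, iter_succ]
    exact step_mono o p H x ih

/-- The iterates stay below every prefixpoint (Knaster–Tarski / Kleene). -/
theorem iter_le_of_step_le {ν : V → Val U} (hν : step o p H x ν ≤ ν) (k : ℕ) :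
    iter o p H x k ≤ ν := by
  induction k with
  | zero => exact bot_le
  | succ k ih =>
    rw [iter_succ]
    exact (step_mono o p H x ih).trans hν

/-- Once two consecutive iterates agree, all later ones do. -/
theorem iter_eq_of_eq {k : ℕ} (h : iter (U := U) o p H x (k + 1) = iter o p H x k) :
    ∀ j, k ≤ j → iter (U := U) o p H x (j + 1) = iter o p H x j := by
  intro j hj
  induction j, hj using Nat.le_induction with
  | base => exact h
  | succ j _ ih =>
    rw [iter_succ, ih, ← iter_succ]
    exact ih

/-- **Stabilisation**: after `|V| · |Val U|` rounds the iteration has reached its fixpoint (every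
strict round raises the total rank `∑_u #{m | m < μ u}` by at least one). -/
theorem iter_stable :
    iter (U := U) o p H x (Fintype.card V * Fintype.card (Val U) + 1) =
      iter o p H x (Fintype.card V * Fintype.card (Val U)) := by
  classical
  set N := Fintype.card V * Fintype.card (Val U) with hN
  by_contra hne
  -- all earlier rounds are strict
  have hstrict : ∀ k, k ≤ N → iter (U := U) o p H x (k + 1) ≠ iter o p H x k :=
    fun k hk heq => hne (iter_eq_of_eq o p H x heq N hk)
  -- the potential
  set Φ : ℕ → ℕ := fun k => ∑ u, (Finset.univ.filter fun m : Val U => m < iter o p H x k u).card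
    with hΦ
  have hsub : ∀ {a b : Val U}, a ≤ b →
      (Finset.univ.filter fun m : Val U => m < a) ⊆
        (Finset.univ.filter fun m : Val U => m < b) := fun hab m hm =>
    Finset.mem_filter.2 ⟨Finset.mem_univ _, lt_of_lt_of_le (Finset.mem_filter.1 hm).2 hab⟩
  have hcard_mono : ∀ {a b : Val U}, a ≤ b →
      (Finset.univ.filter fun m : Val U => m < a).card ≤
        (Finset.univ.filter fun m : Val U => m < b).card := fun hab =>
    Finset.card_le_card (hsub hab)
  have hcard_strict : ∀ {a b : Val U}, a < b →
      (Finset.univ.filter fun m : Val U => m < a).card <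
        (Finset.univ.filter fun m : Val U => m < b).card := by
    intro a b hab
    apply Finset.card_lt_card
    rw [Finset.ssubset_iff_subset_ne]
    refine ⟨hsub hab.le, fun heq => ?_⟩
    have ha : a ∈ Finset.univ.filter fun m : Val U => m < b :=
      Finset.mem_filter.2 ⟨Finset.mem_univ _, hab⟩
    rw [← heq] at ha
    exact lt_irrefl _ (Finset.mem_filter.1 ha).2
  have hgrow : ∀ k, k ≤ N + 1 → k ≤ Φ k := by
    intro k hk
    induction k with
    | zero => exact Nat.zero_le _
    | succ k ih =>
      have hk' : k ≤ N := Nat.le_of_succ_le_succ hk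
      have hle : iter (U := U) o p H x k ≤ iter o p H x (k + 1) := iter_le_iter_succ o p H x k
      obtain ⟨u, hu⟩ : ∃ u, iter (U := U) o p H x k u < iter o p H x (k + 1) u := by
        by_contra hno
        push Not at hno
        exact hstrict k hk' (funext fun u => le_antisymm (hno u) (hle u))
      have hlt : Φ k < Φ (k + 1) :=
        Finset.sum_lt_sum (fun w _ => hcard_mono (hle w)) ⟨u, Finset.mem_univ _, hcard_strict hu⟩
      have := ih (Nat.le_succ_of_le hk')
      omega
  have hbound : ∀ k, Φ k ≤ N := by
    intro k
    calc Φ k ≤ ∑ _u : V, Fintype.card (Val U) :=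
          Finset.sum_le_sum fun u _ => (Finset.card_filter_le _ _).trans (by simp)
      _ = N := by simp [hN]
  have h1 := hgrow (N + 1) le_rfl
  have h2 := hbound (N + 1)
  omega

end Dynamics

end Summit.PneNP.PneNP.Theorems.ParityLifting
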